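import Literature.MathematicalPhysics.QuantumLattice.PeierlsChessboardBound
import Literature.MathematicalPhysics.QuantumLattice.BlockPartitionShiftSelection
import HarnessLib

/-!
# Fröhlich–Lieb (1.44): `⟨Pₘ⁺Pₙ⁻⟩ ≤ Σ_γ κ^{c|γ|}` — the Peierls–chessboard bound with the contour
# length in the exponent (Fröhlich–Lieb 1978, §I.C–I.D)

Topic `MathematicalPhysics/QuantumLattice`. The one-line assembly of
`PeierlsChessboardBound.peierls_chessboard_bound_pow` (FL (1.30) + (1.42): for ANY selection of one
interior boundary bond per cube of a shifted partition, `Re⟨Pₘ⁺Pₙ⁻⟩ ≤ Σ_C κ^{|D_C|}`) with the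
combinatorial lemma `BlockPartitionShiftSelection.exists_shift_cube_selection` (FL (1.43): a
selection with `(b-1)|γ(C)| ≤ b^{2d+1}|D_C|` exists for every `C`):

* `boundaryBonds C` — the ordered bonds `(i, j)`, `i ∈ ∂_in C`, `j ∈ ∂_out C`, `i ∼ j` of the torus
  graph (FL's contour `γ(C)`), `mem_boundaryBonds`;
* `cubePattern_selectedOp_image_eq` — on a selected cube the sub-selected contour pattern is exactly
  the dipole pattern of the selected bond;
* **`peierls_chessboard_bound_contourLength`** — for `H` Hermitian, translation invariant, with
  `-βH` reflection positive across the planes between the cubes of side `b` of `(ℤ/Nbℤ)^d`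
  (`N` even, `N > 1`), real `0 ≤ P±` with `P⁺ + P⁻ = 1`, and `0 ≤ κ ≤ 1` bounding
  `Re⟨P_Λ(p)⟩ ≤ κ^{N^d}` for every DIPOLE cube pattern `p` (FL's `⟨P_Λ⟩^{1/|Λ|}`-type smallness
  input, their §III):
  `Re⟨Pₘ⁺Pₙ⁻⟩_{β,H} ≤ Σ_{C ∈ clusterFamily m n} κ^{(b-1)|γ(C)|/b^{2d+1}}`.

What remains for long-range order à la FL Thm. 1.2/3.x (not here): the number of `C ∋ m` with
`|γ(C)| = ℓ` (FL Thm. 1.1, `d = 2`) and the smallness of `⟨P_Λ⟩` (FL §III).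

## References

* J. Fröhlich, E. H. Lieb, *Phase transitions in anisotropic lattice spin systems*, Comm. Math.
  Phys. **60** (1978) 233–267, §I.C–I.D, eqs. (1.30), (1.41)–(1.45). [FrohlichLieb1978]
-/

noncomputable section

open Matrix Finset NormedSpace
open scoped Kronecker ComplexOrder MatrixOrder BigOperators
open Literature.MathematicalPhysics.QuantumLattice Literature.Probability.LatticeModels
  Literature.Barriers.CriticalPhenomena.NonGibbs

namespace Literature.MathematicalPhysics.QuantumLattice

/-! ### Fröhlich–Lieb (1.44): the bound with the contour length in the exponent -/

section ContourLength

variable {d : ℕ} {N b : ℕ} [NeZero N] [NeZero b] {n : ℕ}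

/-- The ordered boundary bonds `(i, j)`, `i ∈ ∂_in C`, `j ∈ ∂_out C`, `i ∼ j`, of a set `C` of sites
of the torus — the bonds `⟨i, j⟩` of FL's contour `γ(C)`.
[cite: FrohlichLieb1978, §I.C Definition 1] -/
def boundaryBonds [NeZero (N * b)] (C : Finset (TorusSite d (N * b))) :
    Finset (TorusSite d (N * b) × TorusSite d (N * b)) :=
  open Classical in
  (innerBoundary (torusGraph d (N * b)) C ×ˢ outerBoundary (torusGraph d (N * b)) C).filter
    fun β => (torusGraph d (N * b)).Adj β.1 β.2

omit [NeZero N] [NeZero b] in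
/-- Membership in `boundaryBonds`. [cite: FrohlichLieb1978, §I.C Definition 1] -/
theorem mem_boundaryBonds [NeZero (N * b)] {C : Finset (TorusSite d (N * b))}
    {β : TorusSite d (N * b) × TorusSite d (N * b)} :
    β ∈ boundaryBonds C ↔ β.1 ∈ innerBoundary (torusGraph d (N * b)) C ∧
      β.2 ∈ outerBoundary (torusGraph d (N * b)) C ∧ (torusGraph d (N * b)).Adj β.1 β.2 := by
  classical
  unfold boundaryBonds
  rw [mem_filter, mem_product, and_assoc]

/-- On a cube of the selected partition the sub-selected contour pattern IS the dipole pattern of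
the selected bond (no other selected site lies in that cube).
[cite: FrohlichLieb1978, eqs. (1.41)–(1.43)] -/
theorem cubePattern_selectedOp_image_eq [NeZero (N * b)] (hN : Even N)
    (Pp Pm : Matrix (Fin (n + 1)) (Fin (n + 1)) ℂ) (v : TorusSite d (N * b))
    (D : Finset (BlockIdx d N)) (sel : BlockIdx d N → TorusSite d (N * b) × TorusSite d (N * b))
    (hsel : ∀ c ∈ D, blockOf N b ((sel c).1 - v) = c ∧ blockOf N b ((sel c).2 - v) = c)
    {c : BlockIdx d N} (hc : c ∈ D) :
    cubePattern hN v
        (selectedOp Pp Pm (D.image fun c' => (sel c').1) (D.image fun c' => (sel c').2)) c =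
      cubePattern hN v (selectedOp Pp Pm {(sel c).1} {(sel c).2}) c := by
  classical
  funext o
  unfold cubePattern
  set x := blockSite N b (c, cubeUnmirror hN c o) + v with hx
  have hxc : blockOf N b (x - v) = c := by rw [hx, add_sub_cancel_right, blockOf_blockSite]
  have h1 : x ∈ D.image (fun c' => (sel c').1) ↔ x = (sel c).1 := by
    rw [mem_image]
    constructor
    · rintro ⟨c', hc', hx'⟩
      have : c' = c := by rw [← (hsel c' hc').1, hx', hxc]
      rw [← hx', this]
    · intro h; exact ⟨c, hc, h.symm⟩
  have h2 : x ∈ D.image (fun c' => (sel c').2) ↔ x = (sel c).2 := by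
    rw [mem_image]
    constructor
    · rintro ⟨c', hc', hx'⟩
      have : c' = c := by rw [← (hsel c' hc').2, hx', hxc]
      rw [← hx', this]
    · intro h; exact ⟨c, hc, h.symm⟩
  simp only [selectedOp, h1, h2, mem_singleton]

/-- **Fröhlich–Lieb (1.44), complete form: `Re⟨Pₘ⁺Pₙ⁻⟩ ≤ Σ_γ κ^{c(b,d)|γ|}`.** Let `H` be Hermitian
and translation invariant on the torus `(ℤ/Nbℤ)^d` (`N` even, `N > 1`) with `-βH` reflection
positive across the planes between the cubes of side `b`; `0 ≤ P±` real single-site matrices with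
`P⁺ + P⁻ = 1`; and `0 ≤ κ ≤ 1` a bound `Re⟨P_Λ(p)⟩ ≤ κ^{N^d}` for the universal projection of
every DIPOLE cube pattern `p` (`P⁺` at a site `i`, `P⁻` at a nearest neighbour `j` of the same
cube of a shifted partition, identity elsewhere). Then for the nearest-neighbour torus graph and
`m ≠ n`:
`Re⟨Pₘ⁺Pₙ⁻⟩_{β,H} ≤ Σ_{C ∈ clusterFamily m n} κ^{(b-1)|γ(C)|/b^{2d+1}}`, `|γ(C)|` the number of
boundary bonds of `C` (Peierls expansion `peierls_contour_bound`, one interior bond per cube for a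
fraction of the bonds `exists_shift_cube_selection`, chessboard `peierls_chessboard_bound_pow`).
[cite: FrohlichLieb1978, eqs. (1.30), (1.42)–(1.45)] -/
theorem peierls_chessboard_bound_contourLength [NeZero (N * b)] (hd : 0 < d) (hN : Even N)
    (hN1 : 1 < N) {β : ℝ} {H : Op (TorusSite d (N * b)) (n + 1)} (hH : H.IsHermitian)
    (hK : ∀ (i : Fin d) (k : ZMod N),
      IsRPExponent (N * b) i (blockPlane N b k) (hN.mul_right b) (-(β : ℂ) • H))
    (hT : ∀ v : TorusSite d (N * b),
      H.submatrix (fun σ => σ ∘ ⇑(Equiv.addRight v)) (fun σ => σ ∘ ⇑(Equiv.addRight v)) = H)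
    {Pp Pm : Matrix (Fin (n + 1)) (Fin (n + 1)) ℂ} (hPp : Pp.PosSemidef) (hPm : Pm.PosSemidef)
    (hsum : Pp + Pm = 1) (hPpr : Pp.map (starRingEnd ℂ) = Pp) (hPmr : Pm.map (starRingEnd ℂ) = Pm)
    {κ : ℝ} (hκ0 : 0 ≤ κ) (hκ1 : κ ≤ 1)
    (hsmall : ∀ (v i j : TorusSite d (N * b)),
      (∃ k : Fin d, j = i + Pi.single k 1 ∨ i = j + Pi.single k 1) →
      blockOf N b (i - v) = blockOf N b (j - v) →
      (Matrix.gibbsState β H (productOp fun y =>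
        cubePattern hN v (selectedOp Pp Pm {i} {j}) (blockOf N b (i - v))
          (mirroredOffset hN y))).re ≤ κ ^ (N ^ d))
    {m n' : TorusSite d (N * b)} (hmn : m ≠ n') :
    (Matrix.gibbsState β H (onSite m Pp * onSite n' Pm)).re ≤
      ∑ C ∈ clusterFamily (torusGraph d (N * b)) m n',
        κ ^ ((b - 1) * (boundaryBonds C).card / b ^ (2 * d + 1)) := by
  classical
  -- boundary bonds are nearest-neighbour bonds
  have hadj : ∀ (C : Finset (TorusSite d (N * b))), ∀ β' ∈ boundaryBonds C,
      ∃ k : Fin d, β'.2 = β'.1 + Pi.single k 1 ∨ β'.1 = β'.2 + Pi.single k 1 := by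
    intro C β' hβ'
    rcases ((torusGraph_adj_iff _ _).1 (mem_boundaryBonds.1 hβ').2.2).2 with ⟨k, hk⟩ | ⟨k, hk⟩
    · exact ⟨k, Or.inl hk⟩
    · exact ⟨k, Or.inr hk⟩
  -- choose, for every `C`, a shift, cubes and one interior boundary bond per cube
  choose v D sel hsel hcount using fun C : Finset (TorusSite d (N * b)) =>
    exists_shift_cube_selection (boundaryBonds C) (hadj C)
  have hmain := peierls_chessboard_bound_pow hd hN hN1 hH hK hT hPp hPm hsum hPpr hPmr
    (torusGraph d (N * b)) hmn v D (fun C => (D C).image fun c => (sel C c).1)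
    (fun C => (D C).image fun c => (sel C c).2) (fun C _ x hx => ?_) (fun C _ x hx => ?_)
    (fun C _ x hx => ?_) hκ0 (fun C _ c hc => ?_)
  · refine hmain.trans (sum_le_sum fun C _ => pow_le_pow_of_le_one hκ0 hκ1 ?_)
    exact Nat.div_le_of_le_mul (hcount C)
  · obtain ⟨c, hc, rfl⟩ := mem_image.1 hx
    exact (mem_boundaryBonds.1 (hsel C c hc).1).1
  · obtain ⟨c, hc, rfl⟩ := mem_image.1 hx
    exact (mem_boundaryBonds.1 (hsel C c hc).1).2.1
  · rcases mem_union.1 hx with hx | hx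
    · obtain ⟨c, hc, rfl⟩ := mem_image.1 hx
      rw [(hsel C c hc).2.1]; exact hc
    · obtain ⟨c, hc, rfl⟩ := mem_image.1 hx
      rw [(hsel C c hc).2.2]; exact hc
  · have hpat := cubePattern_selectedOp_image_eq hN Pp Pm (v C) (D C) (sel C)
      (fun c' hc' => (hsel C c' hc').2) hc
    have hint : blockOf N b ((sel C c).1 - v C) = blockOf N b ((sel C c).2 - v C) := by
      rw [(hsel C c hc).2.1, (hsel C c hc).2.2]
    have hs := hsmall (v C) (sel C c).1 (sel C c).2 (hadj C _ (hsel C c hc).1) hint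
    rw [(hsel C c hc).2.1] at hs
    simpa only [hpat] using hs

end ContourLength

end Literature.MathematicalPhysics.QuantumLattice

end
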